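import Summits.HodgeConjecture.HodgeConjecture.Theorems.VHCAbelianSchemesRoadWeilLineAnchors
import Summits.HodgeConjecture.HodgeConjecture.Theorems.VHCAbelianSchemesRoadServedFibreLocal
import Summits.HodgeConjecture.HodgeConjecture.Theorems.WeilTypeLadderVariationalLocal
import Summits.HodgeConjecture.HodgeConjecture.Theorems.Ring2AbelianAllSplitWeilClassesDefs
import Summits.HodgeConjecture.CorCM.AndrePolarizedFormHolds
import Literature.AlgebraicGeometry.Andre1996.WeilLineFamilyThroughAnchor
import Literature.AlgebraicGeometry.HodgeTheory.KodairaEmbeddingHyperplaneClass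
import HarnessLib

/-!
# Road b02 (`VHCAbelianSchemesRoad`) × the André column — THE ANCHOR ENGINE: door ∧ the Weil family THROUGH A PRESCRIBED SPLIT ANCHOR ∧ ONE carried
# Weil class AT THAT ANCHOR ⟹ the `E`-Weil line of every split `E`-Weil structure of the same type is algebraic (route-free; every CM field)

research route, not a corollary; conditional on HC_CM plus one named minimal statement.

ROUTE-FREE (imports no `Theses` file of road b02). PART AF of the André column. The LINE engine of PART AD-II
(`VHCAbelianSchemesRoadWeilLineAnchors` §2) runs on André's COMPACT pencil, whose special fibre is only known up to isogeny («`X_{s₀}` isogène à …»), so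
its carrier input had to be asked at EVERY tensor structure over the anchor variety. Print's construction (Deligne 1982, proof of Thm. 4.8, clause (c);
André 1996, proof of Lemme 6.3.3 — Landherr + the hermitian symmetric domain of `Res_{E⁺/ℚ} SU(V, φ)`) puts the variety whose lattice defines `Γ\X⁺` into
the family ON THE NOSE and reaches every split `E`-Weil structure of the same type up to `E`-isogeny (Literature
`andre1996_weilLineFamily_throughSplitAnchor`, statement only, this generation; the quadratic case is the Weil ladder's `weilFamilyReach_hyperbolic`).
With the anchor prescribed, ONE carried class at ONE anchor OF OUR CHOICE per type `(R, e₀, p)` suffices: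

* §1 `weilClassesField_le_algebraicClasses_of_lineFamily_of_door_of_carried` — THE ANCHOR ENGINE (family-generic, fact-free): a smooth projective embedded
  family over a smooth irreducible quasi-projective base, a global `Θ` polarising every fibre, the line clause `IsWeilLineAt` from `s₀` to a chart of
  `A₁ ← B`, and ONE non-zero rational class `w₀ ∈ 𝒲₀` at `s₀` CARRIED modulo the `Θ|_{s₀}`-ray ⟹ `W_E(B) ⊗ ℂ ≤ algebraicClasses B.X p`. Mechanism: the
  line clause extends `w₀` to a global `W'`; the LOCAL served-fibre lemma (`exists_isOpen_forall_mem_algebraicClasses_of_pinnedDatum_at`, PART AC-a: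
  the door at `s₀`) makes `W'` algebraic on an open `U ∋ s₀`; the Hodge-locus/Baire lemma of the Weil ladder
  (`WeilTypeLadder.mem_algebraicClasses_of_isOpen_subset_algebraicityLocus`) on EVERY fibre; at `s₁` the transport `g'^*(e₁^*(W'|_{s₁}))` is a non-zero
  rational algebraic class of the `E`-line `W_E(B)`; one-class lemma (`E` acts by algebraic correspondences, `dim_E W_E = 1`).
* §2 `weilClassesField_le_algebraicClasses_of_throughSplitAnchor_of_door_of_carriedAtAnchor` — fed by the Literature fact: the door ∧
  `andre1996_weilLineFamily_throughSplitAnchor` ∧ a split anchor `(X₀, η₀, e', a')` of type `(R, e₀, p)`, `p > 1`, with ONE non-zero rational `E`-Weil class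
  `w₀` CARRIED AT EVERY CHART of `(X₀, ℚˣ·e'^*a')` ⟹ `W_E(B) ⊗ ℂ` algebraic for EVERY split target `(B, η, e, a)` of the same type. NO hypothesis «Weil classes
  of the anchor algebraic» (the door at the anchor gives it); NO CM hypothesis; `HC_CM` absent.
* §3 `cmHodgeHypothesisAt_of_kodaira_of_andreSplitWeilClasses` — bookkeeping used by the leaf: Kodaira ∧ `AndreSplitWeilClasses` ⟹ `CMHodgeHypothesisAt B`
  for every `B` (Lemme 6.3.2 = André 1992 is CorCM's KERNEL theorem; Kodaira turns its polarization class into a hyperplane class; codimension `≤ 1` by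
  Lefschetz), and `forall_hodgeConjectureFor_of_kodaira_of_andre1996_of_andreSplitWeilClasses_of_door_of_cmAlgebraic` (`HC_AV` with `HC_CM` idle from
  Lemme 6.3.1, Kodaira, the door, CM-algebraic carriers and `AndreSplitWeilClasses`).

HONEST: the family fact enters BY NAME (theorems in print, not formalised); the door is the road's binder; every carrier statement fed to §1–§2 is OPEN,
NOT implied by the Hodge conjecture (it asks for sheaves). Nothing here says any carrier, door, Weil class, `HC_CM`, `HC_AV` or HC holds.
References: [cite: Andre1996Motifs, §6.3 a)–c), proof of Lemme 6.3.3 (pp. 32–33)] [cite: Deligne1982HodgeCycles, §4 proof of Thm. 4.8, Cor. 4.2, Prop. 4.4]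
[cite: Landherr1936HermitianForms] [cite: MoonenZarhin1998WeilClasses, §1] [cite: BuchweitzFlenner2003, §5 Thm. 5.1] [cite: CharlesSchnell2014Notes, Prop. 11.3.11 (proof)]
[cite: Andre1992HodgeCM, Théorème] [cite: Huybrechts2005, Prop. 5.3.1, Cor. 5.3.3] [cite: Bloch1972Semiregularity, Remark (7.5)] [cite: Milne1999, §7 p. 72].
-/

noncomputable section

open CategoryTheory CategoryTheory.Limits AlgebraicGeometry Topology MonoidalCategory CartesianMonoidalCategory

namespace Summit.HodgeConjecture.HodgeConjecture.Ring2.SemiregularRepresentatives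

-- the cell's namespace repeats the summit name (`Summit.HodgeConjecture.HodgeConjecture…`), as in every `Ring2*` file
set_option linter.dupNamespace false

open Literature.AlgebraicGeometry Literature.AlgebraicGeometry.Motives
open Literature.AlgebraicGeometry.HodgeTheory
open Literature.AlgebraicGeometry.Deligne1982
open Literature.AlgebraicGeometry.VanGeemen1994 (pullbackOne)
open Literature.AlgebraicTopology.SingularHomology
open Literature.AlgebraicGeometry.Andre1996 (andre1996_cmAnchoredPencil andre1996_weilLineFamily_throughSplitAnchor IsWeilLineAt)
open Literature.AlgebraicGeometry.Milne1999 (IsOfCMType CMHodgeHypothesisAt)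
open Summit.HodgeConjecture.CorCM.AndreSplit (andre1992_hodgeClasses_cmType_mem_span_pullback_polarizedHyperbolicWeilClassesCM_holds)
open Summit.HodgeConjecture.HodgeConjecture.WeilTypeLadder (mem_algebraicClasses_of_isOpen_subset_algebraicityLocus)
open Summit.Ventures.HSemireg (ObjClass LocalVariationalHodgeFor)
open Summit.HodgeConjecture.HodgeConjecture.Ring2.AbelianAll (carriedClasses AndreSplitWeilClasses)

variable {𝒪 : ObjClass} {n p : ℕ}
variable {B : AbelianVariety ℂ} {η : B ⟶ B} {R : Polynomial ℤ} {e₀ : ℕ}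
  {e : ProjectiveEmbedding B.X} {a : complexBetti (projectiveSpace e.n ℂ) 2}

/-! ## §1 THE ANCHOR ENGINE (family-generic, fact-free) -/

section Engine

variable {𝒳 S : SchemeOver ℂ} {f : 𝒳 ⟶ S}

/-- **THE ANCHOR ENGINE.** The door for `𝒪`; a Weil-type CM datum `(B, η, R, e₀, p)`; a smooth projective family `f : 𝒳 ⟶ S` of relative dimension `n`,
embedded in `ℙᴺ × S`, over a smooth irreducible quasi-projective base; a global class `Θ` polarising every fibre; the LINE clause from `s₀` to a chart
`e₁ : A₁.X ≅ 𝒳_{s₁}` with `g' : B ⟶ A₁` for a set `𝒲₀` of classes at `s₀`; and ONE non-zero rational `w₀ ∈ 𝒲₀` CARRIED modulo the `Θ|_{s₀}`-ray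
(`w₀ ∈ carriedClasses 𝒪 n p 𝒳_{s₀} Θ|_{s₀}`) ⟹ **`W_E(B) ⊗ ℂ ≤ algebraicClasses B.X p`**: extend `w₀` to `W'` (line clause); the door at `s₀` makes `W'` algebraic
on an open `U ∋ s₀` (local served-fibre lemma); the Hodge-locus/Baire lemma spreads it to every fibre; `γ = g'^*(e₁^*(W'|_{s₁})) ∈ W_E(B)` is rational,
algebraic, non-zero; one-class lemma. [cite: Deligne1982HodgeCycles, §4 proof of Thm. 4.8] [cite: BuchweitzFlenner2003, §5 Thm. 5.1]
[cite: CharlesSchnell2014Notes, Prop. 11.3.11 (proof)] [cite: MoonenZarhin1998WeilClasses, §1] [cite: Bloch1972Semiregularity, Remark (7.5)] -/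
theorem weilClassesField_le_algebraicClasses_of_lineFamily_of_door_of_carried (hT : LocalVariationalHodgeFor 𝒪) (hB : IsWeilTypeCM B η R e₀ p)
    (hf : IsSmoothProjectiveFamily f n)
    (hemb : ∃ (N : ℕ) (ι : 𝒳 ⟶ projectiveSpace N ℂ ⊗ S), IsClosedImmersion ι.left ∧ ι ≫ snd (projectiveSpace N ℂ) S = f)
    [IrreducibleSpace S.left] (hsm : AlgebraicGeometry.Smooth S.hom) (hSqp : IsQuasiProjectiveOver S) (Θ : complexBetti 𝒳 2)
    (hΘ : ∀ s : ComplexPoints S, IsPolarizationClass n (fiberOver f s) (complexBetti.map (fiberι f s) 2 Θ))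
    {s₀ s₁ : ComplexPoints S} {A₁ : AbelianVariety ℂ} (e₁ : A₁.X ≅ fiberOver f s₁) (g' : B ⟶ A₁)
    {𝒲₀ : Set (complexBetti (fiberOver f s₀) (2 * p))}
    (hline : IsWeilLineAt f n p s₁ s₀ e₁ g' (weilClassesField B η (R.comp (Polynomial.X ^ 2)) (2 * p)) 𝒲₀)
    {w₀ : complexBetti (fiberOver f s₀) (2 * p)} (hw₀ : w₀ ∈ 𝒲₀) (hw₀Q : IsRationalClass w₀) (hw₀0 : w₀ ≠ 0)
    (hcar : w₀ ∈ carriedClasses 𝒪 n p (fiberOver f s₀) (complexBetti.map (fiberι f s₀) 2 Θ)) :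
    weilClassesField B η (R.comp (Polynomial.X ^ 2)) (2 * p) ≤ algebraicClasses B.X p := by
  -- the line clause: `w₀` extends to a global class `W'`
  obtain ⟨W', hW', hW's₀, hγW, hγne⟩ := hline w₀ hw₀ hw₀Q
  -- the total space is quasi-projective (closed in `ℙᴺ × S`)
  have h𝒳qp : IsQuasiProjectiveOver 𝒳 := by
    obtain ⟨N, ι, hι, -⟩ := hemb
    haveI := hι
    exact IsQuasiProjectiveOver.of_isClosedImmersion_projectiveSpace_tensor ι hSqp
  -- the datum at `s₀`, read on `W'|_{s₀} = w₀`
  obtain ⟨I, κ, a', c, hpI, h𝒪, ha', hκp, hκq⟩ := hcar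
  rw [← hW's₀] at hκp
  -- LOCAL: the door at `s₀`
  obtain ⟨U, hUo, hs₀U, hUalg⟩ := exists_isOpen_forall_mem_algebraicClasses_of_pinnedDatum_at hT hf hsm Θ (fun s ↦ (hΘ s).isRationalClass)
    (fun s ↦ isOfHodgeType_of_mem_algebraicClasses_of_isSmoothProjective (hf.isSmoothProjective s) 1 (hΘ s).mem_algebraicClasses) W'
    (fun s ↦ (hW' s).2) hpI h𝒪 ha' hκp hκq
  -- GLOBAL from LOCAL: the Hodge-locus / Baire lemma
  have hall := mem_algebraicClasses_of_isOpen_subset_algebraicityLocus f h𝒳qp hSqp hsm hf W' hUo ⟨s₀, hs₀U⟩ hUalg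
  -- at `s₁`: a non-zero rational algebraic class of the `E`-line of `B`
  have hγalg : complexBetti.map g'.hom.hom.hom (2 * p) (complexBetti.map e₁.hom (2 * p) (complexBetti.map (fiberι f s₁) (2 * p) W')) ∈
      algebraicClasses B.X p :=
    map_mem_algebraicClasses_of_abelianVariety AbelianVariety.isSmoothProjective_holds A₁ g'.hom.hom.hom
      ((mem_algebraicClasses_map_iff_of_iso e₁).2 (hall s₁))
  have hγQ : IsRationalClass
      (complexBetti.map g'.hom.hom.hom (2 * p) (complexBetti.map e₁.hom (2 * p) (complexBetti.map (fiberι f s₁) (2 * p) W'))) :=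
    ((hW' s₁).1.pullback _).pullback _
  have her : 2 * e₀ * (2 * p) = 2 * B.dim := by rw [hB.dim_eq]; ring
  exact weilClassesField_le_algebraicClasses_of_isRationalClass_of_ne_zero hB.natDegree_comp hB.irreducible hB.eval₂_eq_zero her hB.k_pos hγW hγQ
    (hγne hw₀0) hγalg

end Engine

/-! ## §2 Fed by the Literature fact: one carried class at a prescribed split anchor serves every split target of the same type -/

section ThroughAnchor

variable {X₀ : AbelianVariety ℂ} {η₀ : X₀ ⟶ X₀} {e' : ProjectiveEmbedding X₀.X} {a' : complexBetti (projectiveSpace e'.n ℂ) 2}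
  {w₀ : complexBetti X₀.X (2 * p)}

/-- **ONE CARRIED CLASS AT ONE SPLIT ANCHOR ⟹ THE `E`-WEIL LINE OF EVERY SPLIT STRUCTURE OF THE SAME TYPE.** The door for `𝒪`; the family fact
`andre1996_weilLineFamily_throughSplitAnchor`; a split `E`-Weil anchor `(X₀, η₀, e', a')` of type `(R, e₀, p)`, `p > 1` (`IsWeilTypeCM`, `η₀`-compatible hyperplane
class, `IsHyperbolicWeilType`); a non-zero rational class `w₀ ∈ W_E(X₀) ⊗ ℂ` which, AT EVERY CHART `(X, ε : X₀.X ≅ X, θ)` of `(X₀, ℚˣ·e'^*a')` with `θ` a polarisation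
class, is carried modulo the `θ`-ray (`ε^{-1 *} w₀ ∈ carriedClasses 𝒪 (dim X₀) p X θ`) ⟹ for EVERY split target `(B, η, e, a)` of type `(R, e₀, p)`:
`W_E(B) ⊗ ℂ ≤ algebraicClasses B.X p`. NO hypothesis that the anchor's Weil classes are algebraic, NO CM hypothesis, `HC_CM` absent.
[cite: Andre1996Motifs, proof of Lemme 6.3.3 (p. 33)] [cite: Deligne1982HodgeCycles, §4 proof of Thm. 4.8 (clauses (a)–(c))] [cite: Landherr1936HermitianForms]
[cite: MoonenZarhin1998WeilClasses, §1] [cite: Bloch1972Semiregularity, Remark (7.5)] -/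
theorem weilClassesField_le_algebraicClasses_of_throughSplitAnchor_of_door_of_carriedAtAnchor (h : andre1996_weilLineFamily_throughSplitAnchor)
    (hT : LocalVariationalHodgeFor 𝒪) (hp : 1 < p) (hX₀ : IsWeilTypeCM X₀ η₀ R e₀ p) (ha' : IsRationalClass a') (ha'₀ : a' ≠ 0)
    (hRos₀ : ∀ x y : complexBetti X₀.X 1,
      polarizationPairingOne X₀.X (complexBetti.map e'.ι 2 a') (X₀.dim - 1) (pullbackOne X₀ η₀ x) y =
        -polarizationPairingOne X₀.X (complexBetti.map e'.ι 2 a') (X₀.dim - 1) x (pullbackOne X₀ η₀ y))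
    (hsplit₀ : IsHyperbolicWeilType X₀ η₀ (p * e₀) (complexBetti.map e'.ι 2 a'))
    (hw₀W : w₀ ∈ weilClassesField X₀ η₀ (R.comp (Polynomial.X ^ 2)) (2 * p)) (hw₀Q : IsRationalClass w₀) (hw₀0 : w₀ ≠ 0)
    (hcar : ∀ (X : SchemeOver ℂ) (ε : X₀.X ≅ X) (θ : complexBetti X 2) (c : ℚ), c ≠ 0 →
      complexBetti.map ε.hom 2 θ = (c : ℂ) • complexBetti.map e'.ι 2 a' → IsPolarizationClass X₀.dim X θ →
      complexBetti.map ε.inv (2 * p) w₀ ∈ carriedClasses 𝒪 X₀.dim p X θ)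
    (hB : IsWeilTypeCM B η R e₀ p) (ha : IsRationalClass a) (ha₀ : a ≠ 0)
    (hRos : ∀ x y : complexBetti B.X 1,
      polarizationPairingOne B.X (complexBetti.map e.ι 2 a) (B.dim - 1) (pullbackOne B η x) y =
        -polarizationPairingOne B.X (complexBetti.map e.ι 2 a) (B.dim - 1) x (pullbackOne B η y))
    (hsplit : IsHyperbolicWeilType B η (p * e₀) (complexBetti.map e.ι 2 a)) :
    weilClassesField B η (R.comp (Polynomial.X ^ 2)) (2 * p) ≤ algebraicClasses B.X p := by
  obtain ⟨𝒳, S, f, s₀, s₁, e₀', Θ, c, A₁, e₁, g', hf, hemb, hirr, hsm, hSqp, hΘ, hc, hΘ₀, hline⟩ :=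
    h R e₀ p hp X₀ η₀ e' a' hX₀ ha' ha'₀ hRos₀ hsplit₀ B η e a hB ha ha₀ hRos hsplit
  haveI := hirr
  -- the carried class read on the anchor fibre
  have hback : complexBetti.map e₀'.hom (2 * p) (complexBetti.map e₀'.inv (2 * p) w₀) = w₀ := e₀'.complexBetti_map_hom_map_inv _ _
  have hmem : complexBetti.map e₀'.inv (2 * p) w₀ ∈
      {w | complexBetti.map e₀'.hom (2 * p) w ∈ weilClassesField X₀ η₀ (R.comp (Polynomial.X ^ 2)) (2 * p)} := by
    rw [Set.mem_setOf_eq, hback]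
    exact hw₀W
  have h0' : complexBetti.map e₀'.inv (2 * p) w₀ ≠ 0 := fun h0 ↦ hw₀0 (by rw [← hback, h0, map_zero])
  exact weilClassesField_le_algebraicClasses_of_lineFamily_of_door_of_carried hT hB hf hemb hsm hSqp Θ hΘ e₁ g' hline hmem (hw₀Q.pullback _) h0'
    (hcar (fiberOver f s₀) e₀' (complexBetti.map (fiberι f s₀) 2 Θ) c hc hΘ₀ (hΘ s₀))

/-- **The same, one rational class at a time** (the format of `AbelianAll.AndreSplitWeilClasses`). [cite: Andre1996Motifs, proof of Lemme 6.3.3 (p. 33)]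
[cite: Deligne1982HodgeCycles, §4 proof of Thm. 4.8] [cite: MoonenZarhin1998WeilClasses, §1] -/
theorem splitWeilClass_mem_algebraicClasses_of_throughSplitAnchor_of_door_of_carriedAtAnchor (h : andre1996_weilLineFamily_throughSplitAnchor)
    (hT : LocalVariationalHodgeFor 𝒪) (hp : 1 < p) (hX₀ : IsWeilTypeCM X₀ η₀ R e₀ p) (ha' : IsRationalClass a') (ha'₀ : a' ≠ 0)
    (hRos₀ : ∀ x y : complexBetti X₀.X 1,
      polarizationPairingOne X₀.X (complexBetti.map e'.ι 2 a') (X₀.dim - 1) (pullbackOne X₀ η₀ x) y =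
        -polarizationPairingOne X₀.X (complexBetti.map e'.ι 2 a') (X₀.dim - 1) x (pullbackOne X₀ η₀ y))
    (hsplit₀ : IsHyperbolicWeilType X₀ η₀ (p * e₀) (complexBetti.map e'.ι 2 a'))
    (hw₀W : w₀ ∈ weilClassesField X₀ η₀ (R.comp (Polynomial.X ^ 2)) (2 * p)) (hw₀Q : IsRationalClass w₀) (hw₀0 : w₀ ≠ 0)
    (hcar : ∀ (X : SchemeOver ℂ) (ε : X₀.X ≅ X) (θ : complexBetti X 2) (c : ℚ), c ≠ 0 →
      complexBetti.map ε.hom 2 θ = (c : ℂ) • complexBetti.map e'.ι 2 a' → IsPolarizationClass X₀.dim X θ →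
      complexBetti.map ε.inv (2 * p) w₀ ∈ carriedClasses 𝒪 X₀.dim p X θ)
    (hB : IsWeilTypeCM B η R e₀ p) (ha : IsRationalClass a) (ha₀ : a ≠ 0)
    (hRos : ∀ x y : complexBetti B.X 1,
      polarizationPairingOne B.X (complexBetti.map e.ι 2 a) (B.dim - 1) (pullbackOne B η x) y =
        -polarizationPairingOne B.X (complexBetti.map e.ι 2 a) (B.dim - 1) x (pullbackOne B η y))
    (hsplit : IsHyperbolicWeilType B η (p * e₀) (complexBetti.map e.ι 2 a))
    {w : complexBetti B.X (2 * p)} (hw : w ∈ weilClassesField B η (R.comp (Polynomial.X ^ 2)) (2 * p)) :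
    w ∈ algebraicClasses B.X p :=
  weilClassesField_le_algebraicClasses_of_throughSplitAnchor_of_door_of_carriedAtAnchor h hT hp hX₀ ha' ha'₀ hRos₀ hsplit₀ hw₀W hw₀Q hw₀0 hcar hB ha ha₀
    hRos hsplit hw

end ThroughAnchor

/-! ## §3 Bookkeeping for the leaf: `HC_CM` and `HC_AV` from `AndreSplitWeilClasses` with Kodaira and the kernel CM reduction -/

section Assembly

/-- **`CMHodgeHypothesisAt B ⟸ Kodaira ∧ AndreSplitWeilClasses`** for every `B`: a rational `(p,p)` class on a CM abelian variety, `p > 1`, lies in the span of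
pull-backs `g^*(w)` of rational Weil classes of POLARIZED hyperbolic split CM-field data (André 1992 = Lemme 6.3.2, CorCM's KERNEL theorem
`andre1992_hodgeClasses_cmType_mem_span_pullback_polarizedHyperbolicWeilClassesCM_holds`); Kodaira makes the polarization class a hyperplane class, so
`AndreSplitWeilClasses` applies; pull-backs of algebraic classes are algebraic; codimension `≤ 1` is Lefschetz. [cite: Andre1992HodgeCM, Théorème]
[cite: Andre1996Motifs, Lemme 6.3.2 (p. 32)] [cite: Huybrechts2005, Prop. 5.3.1, Cor. 5.3.3] [cite: Milne1999, §7 p. 72] -/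
theorem cmHodgeHypothesisAt_of_kodaira_of_andreSplitWeilClasses (hK : Kodaira1954_rationalKaehlerClass_eq_hyperplaneClass) (hS : AndreSplitWeilClasses)
    (B : AbelianVariety ℂ) : CMHodgeHypothesisAt B := by
  intro hB hCM
  refine (hodgeConjectureFor_iff_of_isSmoothProjective nonempty_hodgeModel_holds hB).2 ?_
  intro p c hc hpp
  by_cases hp : p ≤ 1
  · exact (mem_algebraicClasses_and_divisorClassesSpan_of_offMidRange hB (Or.inl hp) c hc hpp).1
  obtain ⟨R, e₀, -, hspan⟩ := andre1992_hodgeClasses_cmType_mem_span_pullback_polarizedHyperbolicWeilClassesCM_holds B hCM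
  refine (Submodule.span_le.mpr ?_) (hspan p (by omega) c hc hpp)
  rintro _ ⟨B', g, η', w, -, hP, hw, hwQ, -, rfl⟩
  obtain ⟨hW, h, hpol, hKm, hros, -, hhyp⟩ := hP
  have hd : 0 < B'.dim := by have := hW.two_le_dim; omega
  obtain ⟨e, a, ha, ha0, hea⟩ := hK (AbelianVariety.isSmoothProjective_holds (A := B')) hd h hpol.isRationalClass hKm
  rw [← hea] at hros hhyp
  exact map_mem_algebraicClasses_of_abelianVariety hB B' g.hom.hom.hom (hS B' η' R e₀ p e a hW ha ha0 hros hhyp w hw hwQ)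

/-- **`HC_AV` with `HC_CM` IDLE from `AndreSplitWeilClasses`**: Lemme 6.3.1 (`andre1996_cmAnchoredPencil`) ∧ Kodaira ∧ the door for `𝒪` ∧ CM-algebraic carriers
(`2 ≤ p`, `2p + 4 ≤ n`) ∧ `AndreSplitWeilClasses` ⟹ `∀ A, HodgeConjectureFor A.dim A.X`. [cite: Andre1996Motifs, §6.3 Lemmes 6.3.1–6.3.2 (pp. 31–32)]
[cite: Andre1992HodgeCM, Théorème] [cite: Bloch1972Semiregularity, Remark (7.5)] -/
theorem forall_hodgeConjectureFor_of_kodaira_of_andre1996_of_andreSplitWeilClasses_of_door_of_cmAlgebraic (h₂₁ : andre1996_cmAnchoredPencil)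
    (hK : Kodaira1954_rationalKaehlerClass_eq_hyperplaneClass) (hT : LocalVariationalHodgeFor 𝒪)
    (hcm : ∀ n p : ℕ, 2 ≤ p → 2 * p + 4 ≤ n → AnchoredCarrierAt 𝒪 n p
      (fun X θ ↦ (∃ A₀ : AbelianVariety ℂ, A₀.dim = n ∧ IsOfCMType A₀ ∧ Nonempty (A₀.X ≅ X)) ∧ IsPolarizationClass n X θ)
      (fun X _ ↦ (algebraicClasses X p : Set (complexBetti X (2 * p)))))
    (hS : AndreSplitWeilClasses) : ∀ A : AbelianVariety ℂ, HodgeConjectureFor A.dim A.X :=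
  forall_hodgeConjectureFor_of_cmAnchoredPencil_of_cmHodge_of_cmAlgebraicCarrierAt h₂₁ hT (cmHodgeHypothesisAt_of_kodaira_of_andreSplitWeilClasses hK hS) hcm

end Assembly

/-! ## §4 (appended) The CHART (`∀∃`) form: SOME carried class at the chart the family produces suffices -/

section ThroughAnchorChart

variable {X₀ : AbelianVariety ℂ} {η₀ : X₀ ⟶ X₀} {e' : ProjectiveEmbedding X₀.X} {a' : complexBetti (projectiveSpace e'.n ℂ) 2}

/-- **THE `∀∃` FORM OF §2.** The door for `𝒪`; the family fact; a split anchor `(X₀, η₀, e', a')` of type `(R, e₀, p)`, `p > 1`; and AT EVERY CHART `(X, ε : X₀.X ≅ X, θ)` of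
`(X₀, ℚˣ·e'^*a')` with `θ` a polarisation class, SOME non-zero rational class `w` on `X` with `ε^*w` in the `E`-Weil line of `(X₀, η₀)` carried modulo the `θ`-ray
(the class may depend on the chart) ⟹ `W_E(B) ⊗ ℂ ≤ algebraicClasses B.X p` for EVERY split target of the type. The engine of §1 only ever uses the chart the family
produces, so this weaker input suffices; §2 is the special case `w := ε^{-1 *}w₀`. [cite: Andre1996Motifs, proof of Lemme 6.3.3 (p. 33)]
[cite: Deligne1982HodgeCycles, §4 proof of Thm. 4.8 (clauses (a)–(c))] [cite: MoonenZarhin1998WeilClasses, §1] [cite: Bloch1972Semiregularity, Remark (7.5)] -/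
theorem weilClassesField_le_algebraicClasses_of_throughSplitAnchor_of_door_of_chartCarried (h : andre1996_weilLineFamily_throughSplitAnchor)
    (hT : LocalVariationalHodgeFor 𝒪) (hp : 1 < p) (hX₀ : IsWeilTypeCM X₀ η₀ R e₀ p) (ha' : IsRationalClass a') (ha'₀ : a' ≠ 0)
    (hRos₀ : ∀ x y : complexBetti X₀.X 1,
      polarizationPairingOne X₀.X (complexBetti.map e'.ι 2 a') (X₀.dim - 1) (pullbackOne X₀ η₀ x) y =
        -polarizationPairingOne X₀.X (complexBetti.map e'.ι 2 a') (X₀.dim - 1) x (pullbackOne X₀ η₀ y))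
    (hsplit₀ : IsHyperbolicWeilType X₀ η₀ (p * e₀) (complexBetti.map e'.ι 2 a'))
    (hcar : ∀ (X : SchemeOver ℂ) (ε : X₀.X ≅ X) (θ : complexBetti X 2) (c : ℚ), c ≠ 0 →
      complexBetti.map ε.hom 2 θ = (c : ℂ) • complexBetti.map e'.ι 2 a' → IsPolarizationClass X₀.dim X θ →
      ∃ w : complexBetti X (2 * p), IsRationalClass w ∧ w ≠ 0 ∧
        complexBetti.map ε.hom (2 * p) w ∈ weilClassesField X₀ η₀ (R.comp (Polynomial.X ^ 2)) (2 * p) ∧ w ∈ carriedClasses 𝒪 X₀.dim p X θ)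
    (hB : IsWeilTypeCM B η R e₀ p) (ha : IsRationalClass a) (ha₀ : a ≠ 0)
    (hRos : ∀ x y : complexBetti B.X 1,
      polarizationPairingOne B.X (complexBetti.map e.ι 2 a) (B.dim - 1) (pullbackOne B η x) y =
        -polarizationPairingOne B.X (complexBetti.map e.ι 2 a) (B.dim - 1) x (pullbackOne B η y))
    (hsplit : IsHyperbolicWeilType B η (p * e₀) (complexBetti.map e.ι 2 a)) :
    weilClassesField B η (R.comp (Polynomial.X ^ 2)) (2 * p) ≤ algebraicClasses B.X p := by
  obtain ⟨𝒳, S, f, s₀, s₁, e₀', Θ, c, A₁, e₁, g', hf, hemb, hirr, hsm, hSqp, hΘ, hc, hΘ₀, hline⟩ :=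
    h R e₀ p hp X₀ η₀ e' a' hX₀ ha' ha'₀ hRos₀ hsplit₀ B η e a hB ha ha₀ hRos hsplit
  haveI := hirr
  obtain ⟨w, hwQ, hw0, hwW, hwc⟩ := hcar (fiberOver f s₀) e₀' (complexBetti.map (fiberι f s₀) 2 Θ) c hc hΘ₀ (hΘ s₀)
  exact weilClassesField_le_algebraicClasses_of_lineFamily_of_door_of_carried hT hB hf hemb hsm hSqp Θ hΘ e₁ g' hline hwW hwQ hw0 hwc

end ThroughAnchorChart

end Summit.HodgeConjecture.HodgeConjecture.Ring2.SemiregularRepresentatives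

end
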